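import Summits.BirchSwinnertonDyer.BirchSwinnertonDyer.Theorems.ByReductionTypeAtTwoMultTransportTwistedDescentKummerStrict
import HarnessLib

/-!
# T-42-mult in the kernel, XXXII: ONE Tate line at a multiplicative place above `2` carrying BOTH inclusions of
# Greenberg's Prop. 2.4 in local cochain form (`Im κ = Im λ` over `(F_∞)_η`) — the local package of `T2`

Cell `bsd-2adic` (run/shared/lean/pub/bsd-2adic/), seat `bsd-2adic-t42` (BRIEF-T42), GEN 17. HONEST FRAMING:
research route; THEOREMS ONLY (no `def`, no named fact, no instance); nothing booked; nothing re-keyed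
(RC-169); BSD is not proved by any of this. PARTITION: X5@2 multiplicative GV-transport rows (K4ᵐ B1·O1; the
LOCAL statement `T2` at `2`, last open input of `hF3b` after XXX) × p = 2 — types-the-object-of; bears_on K4 items
19922 / 19923 (`--supports stmt-BirchSwinnertonDyer-19923`).

`T2` must use ONE line `C ⊆ E[2^∞]` for both directions: XXVII (`C`-valued / strict cocycles of
`G_K = (ker κ)_v` are Kummer, `Im λ ⊆ Im κ`) and XXXI (Kummer coboundaries of any subgroup are `C`-valued modulo a
coboundary, `Im κ ⊆ Im λ`), both for the Tate line `ι⁻¹Ψ(μ)` of the SAME twisted Tate uniformisation `Ψ`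
(`exists_twistedTateUniformisation_tateJ`, Silverman *ATAEC* V.5.3). This file packages them:
**`exists_tateLine_localKummer_two`**. (XXVII's `exists_tateLine_localKummer` hides its `Ψ`, so its line cannot
be matched with XXXI's a posteriori; hence the re-packaging.)

References: [GreenbergLNM1716] §2 Prop. 2.4, pp. 74–76; [GreenbergVatsal2000] §2 pp. 14–15;
[SilvermanATAEC1994] Lemma V.5.2 (c), Thm. V.5.3.
-/

set_option autoImplicit false
set_option linter.dupNamespace false

noncomputable section

open scoped Classical AddSubgroup

namespace Summit.BirchSwinnertonDyer.BirchSwinnertonDyer.Theorems.MultTransportTwistedDescent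

open NumberField IsDedekindDomain Field WeierstrassCurve
  Literature.NumberTheory.GaloisRepresentations Literature.NumberTheory.EllipticCurves
  Literature.NumberTheory.EllipticCurves.GreenbergSelmer IsDedekindDomain.HeightOneSpectrum
  Literature.NumberTheory.EllipticCurves.TateCurve
  Summit.BirchSwinnertonDyer.Rank1Residual.X2

variable {F : Type} [Field F] [NumberField F] (W : WeierstrassCurve F) [W.IsElliptic]
  (κ : ZpExtension F 2) {v : HeightOneSpectrum (𝓞 F)}

/-- **The local package at a multiplicative place `v ∣ 2`.** There is a line `C ⊆ E[2^∞]` (a `LocalDatum`: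
stable under the decomposition group), `2`-divisible with `#C[2] = 2`, such that for the cyclotomic
`ℤ_2`-extension `κ` and `G_K = (ker κ)_v` (`K = (F_∞)_η`):
(i) every continuous `C`-valued crossed homomorphism of `G_K` into `E[2^∞]` is a Kummer coboundary;
(ii) so is every continuous crossed homomorphism of `G_K` that is a coboundary modulo `C` (`Im λ_K ⊆ Im κ_K`);
(iii) conversely, for EVERY subgroup `G ≤ Γ_{F_v}` and every point `Q ∈ E(F̄_v)`, a map `k : G → E[2^∞]` with
`ι(k τ) = τQ − Q` is `C`-valued modulo a coboundary (`Im κ ⊆ Im λ`, any subgroup).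
[cite: GreenbergLNM1716, §2 Prop. 2.4 (pp. 74–75) and pp. 75–76] [cite: GreenbergVatsal2000, §2 pp. 14–15]
[cite: SilvermanATAEC1994, Lemma V.5.2 (c), Thm. V.5.3] -/
theorem exists_tateLine_localKummer_two (hκ : κ.IsCyclotomic) (hv : W.HasMultiplicativeReductionAt v) :
    ∃ N : LocalDatum F (W.geomPrimaryTorsion 2) v,
      (∀ c ∈ N.plus, ∃ c' ∈ N.plus, 2 • c' = c) ∧
      Nat.card ↥(N.plus ⊓ (↥(W.geomPrimaryTorsion 2))[(2 : ℤ)]) = 2 ∧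
      (∀ (f : localSubgroup κ.kerSubgroup (v.adicCompletion F) → W.geomPrimaryTorsion 2),
        (∀ τ, f τ ∈ N.plus) → Continuous f →
        (∀ τ₁ τ₂, f (τ₁ * τ₂) = f τ₁ + resGal (K := F) (v.adicCompletion F)
          (τ₁ : absoluteGaloisGroup (v.adicCompletion F)) • f τ₂) →
        ∃ Q : localPoints W (v.adicCompletion F),
          ∀ τ : localSubgroup κ.kerSubgroup (v.adicCompletion F),
            pointsMap W (v.adicCompletion F) (f τ : W.geomPoints) =
              (τ : absoluteGaloisGroup (v.adicCompletion F)) • Q - Q) ∧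
      (∀ (f : localSubgroup κ.kerSubgroup (v.adicCompletion F) → W.geomPrimaryTorsion 2)
        (m₀ : W.geomPrimaryTorsion 2),
        (∀ τ, f τ - (resGal (K := F) (v.adicCompletion F)
          (τ : absoluteGaloisGroup (v.adicCompletion F)) • m₀ - m₀) ∈ N.plus) → Continuous f →
        (∀ τ₁ τ₂, f (τ₁ * τ₂) = f τ₁ + resGal (K := F) (v.adicCompletion F)
          (τ₁ : absoluteGaloisGroup (v.adicCompletion F)) • f τ₂) →
        ∃ Q : localPoints W (v.adicCompletion F),
          ∀ τ : localSubgroup κ.kerSubgroup (v.adicCompletion F),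
            pointsMap W (v.adicCompletion F) (f τ : W.geomPoints) =
              (τ : absoluteGaloisGroup (v.adicCompletion F)) • Q - Q) ∧
      (∀ (G : Subgroup (absoluteGaloisGroup (v.adicCompletion F))) (Q : localPoints W (v.adicCompletion F))
        (k : G → W.geomPrimaryTorsion 2),
        (∀ τ : G, pointsMap W (v.adicCompletion F) (k τ : W.geomPoints) =
          (τ : absoluteGaloisGroup (v.adicCompletion F)) • Q - Q) →
        ∃ m₀ : W.geomPrimaryTorsion 2, ∀ τ : G,
          k τ - (resGal (K := F) (v.adicCompletion F) (τ : absoluteGaloisGroup (v.adicCompletion F)) • m₀ - m₀)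
            ∈ N.plus) := by
  obtain ⟨q, t, Ψ, hq0, hq1, -, -, -, ht2, hsurj, hker, hΨσ⟩ := exists_twistedTateUniformisation_tateJ W v hv
  have hts := GreenbergVatsalTateKummer.smul_sqrt_eq_or W t ht2
  have hΦ : ∀ (σ : absoluteGaloisGroup (v.adicCompletion F))
      (u : (AlgebraicClosure (v.adicCompletion F))ˣ),
      σ • Ψ (Additive.ofMul u) = Ψ (Additive.ofMul (Units.map
        (Field.absoluteGaloisGroup.toAlgEquiv (v.adicCompletion F) σ :
          AlgebraicClosure (v.adicCompletion F) →* AlgebraicClosure (v.adicCompletion F)) u)) ∨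
      σ • Ψ (Additive.ofMul u) = -Ψ (Additive.ofMul (Units.map
        (Field.absoluteGaloisGroup.toAlgEquiv (v.adicCompletion F) σ :
          AlgebraicClosure (v.adicCompletion F) →* AlgebraicClosure (v.adicCompletion F)) u)) := by
    intro σ u
    rw [hΨσ σ u]
    split_ifs
    · exact Or.inl (one_zsmul _)
    · exact Or.inr (by rw [neg_one_zsmul])
  refine ⟨GreenbergVatsalTateDatum.tateDatum W 2 Ψ hΦ,
    GreenbergVatsalTateDatumCofree.tateDatum_plus_divisible W 2 Ψ hΦ,
    GreenbergVatsalTateDatumCofree.natCard_tateDatum_plus_inf_torsionBy W 2 Ψ hΦ hq0 hq1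
      (fun u h ↦ (hker u).1 h), ?_, ?_, ?_⟩
  · intro f hfC hfcont hfcoc
    exact exists_kummerPoint_of_cocycle_mem_plus W 2 κ Ψ t hq0 hq1 (fun u h ↦ (hker u).1 h) hΨσ hts
      _ (GreenbergVatsalTateDatum.mem_tateDatum_plus_iff hΦ) hκ f hfC hfcont hfcoc
  · intro f m₀ hfC hfcont hfcoc
    exact exists_kummerPoint_of_cocycle_strict W 2 κ Ψ t hq0 hq1 (fun u h ↦ (hker u).1 h) hΨσ hts
      _ (GreenbergVatsalTateDatum.mem_tateDatum_plus_iff hΦ) hκ f m₀ hfC hfcont hfcoc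
  · intro G Q k hk
    exact exists_sub_coboundary_mem_plus W Ψ t hq0 hq1 hker hΨσ hts hsurj _
      (GreenbergVatsalTateDatum.mem_tateDatum_plus_iff hΦ) G Q k hk

end Summit.BirchSwinnertonDyer.BirchSwinnertonDyer.Theorems.MultTransportTwistedDescent

end
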